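import Literature.LinearAlgebra.Matrix.CrystallographicRestriction
import Mathlib.RingTheory.AdjoinRoot
import Mathlib.RingTheory.RootsOfUnity.Complex
import Mathlib.LinearAlgebra.Matrix.Reindex
import Mathlib.NumberTheory.Bertrand
import Mathlib.Data.Nat.Squarefree
import HarnessLib

/-!
# The crystallographic restriction, sufficiency: every `m` with `ψ(m) ≤ n` is the order of an
# `n × n` integer matrix (Bamberg–Cairns–Kilminster 2003, Thm. 1, the inclusion `⊇`), hence Theorem 1

Layer `Literature/LinearAlgebra/Matrix`, namespace `Literature.LinearAlgebra.Matrix`; the sequel of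
`CrystallographicRestriction` (the inclusion `Ord_n ⊆ {m | ψ(m) ≤ n}`), completing **Theorem 1 of
[BCK]: `Ord_n = {m ∈ ℕ | ψ(m) ≤ n}`** (`setOf_orderOf_eq_setOf_crPsi_le`). Mathlib only (cyclotomic
polynomials, `AdjoinRoot`, `Algebra.leftMulMatrix`, primitive roots of unity in `ℂ`); theorems and no
definition, no named fact.

Source (held copy `paper:doi-10-2307-3647934`, p0001 L28–L41): "**Theorem 1.** `Ord_n = {m ∈ ℕ |
ψ(m) ≤ n}`", `Ord_n = {m ∈ ℕ | ∃A ∈ GL(n, ℤ) with Ord(A) = m}`; the proof referred to (p0002 L38) is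
J. Kuzmanovich, A. Pavlichenkov, *Finite groups of matrices whose entries are integers*, Amer. Math.
Monthly 109 (2002), Thm. 2.7, whose sufficiency half is the classical construction followed here:
the companion matrix of the cyclotomic polynomial `Φ_d` is an integer matrix of size `φ(d)` and order
`d`; for `m = ∏ pᵢ^{rᵢ}` the block sum of the companions of the `Φ_{pᵢ^{rᵢ}}` has size `Σ φ(pᵢ^{rᵢ})`
and order `m`, and when `2 ‖ m` the factor `Φ₂` (size `1`) is saved by taking MINUS the block sum for
`m/2` (odd order `m/2`, so `−B` has order `m`) — this is the exception `ψ(2) = 0`; finally pad with an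
identity block.

## What is proved

* `isPrimitiveRoot_root_prod_cyclotomic` — in `ℤ[X]/(∏_{p ∣ m} Φ_{p^{v_p(m)}})` the class of `X` is a
  primitive `m`-th root of unity (`∏ Φ ∣ X^m − 1`; conversely `Φ_{p^r} ∣ X^k − 1` forces `p^r ∣ k`,
  read off at a primitive `p^r`-th root of unity in `ℂ`);
* `exists_matrix_orderOf_eq_of_ne` — for `v₂(m) ≠ 1` an integer matrix of size `ψ(m)` and order `m`
  (the regular representation `Algebra.leftMulMatrix` of that class in the power basis);
  `exists_matrix_orderOf_eq_of_eq` — for `v₂(m) = 1`, `m ≠ 2`, likewise (minus the matrix for `m/2`);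
* `orderOf_fromBlocks_one` (padding by an identity block) and `orderOf_reindex`;
* **`exists_matrix_orderOf_eq_of_crPsi_le`** — `0 < m`, `0 < n`, `ψ(m) ≤ n` ⟹ some
  `A ∈ M_n(ℤ)` has `orderOf A = m` (such an `A` is invertible: `exists_gl_orderOf_eq_of_crPsi_le`);
* **`setOf_orderOf_eq_setOf_crPsi_le`** — **Theorem 1**: for `n ≥ 1`,
  `{m ≥ 1 | ∃ A ∈ M_n(ℤ), ord A = m} = {m ≥ 1 | ψ(m) ≤ n}` (with `crPsi_orderOf_le_card_int` of the
  prequel for `⊆`);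
* (append) the remark after Theorem 1, p0002 L41: "Notice that `ψ(m)` is even for all `m`, so
  `Ord_{2k+1} = Ord_{2k}` for all `k ≥ 1`. Hence it suffices to consider `Ord_n` for even `n`" —
  `even_crPsi`, `crPsi_le_two_mul_add_one_iff`, **`setOf_orderOf_odd_eq_setOf_orderOf_even`**,
  `setOf_orderOf_eq_setOf_orderOf_two_mul_div_two`; and PROPOSITION 3 (2), p0006 L17–L35: "`ψ⁻¹{n}` is
  nonempty for all even `n ≥ 2`" — "the function `ψ` maps `ℕ` onto the set of even nonnegative integers
  … for every even number `n ≥ 2` there are distinct odd primes `p₁, …, p_k` such that `ψ(p₁ ⋯ p_k) = n`.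
  The proof is by induction on `n` … By Bertrand's postulate …" — `le_crPsi_add_one_of_mem_primeFactors_of_odd`,
  **`exists_odd_squarefree_crPsi_eq`**, `exists_crPsi_eq_of_even`, **`range_crPsi`** (`= {even}`),
  **`exists_orderOf_eq_and_not`** (`Ord_{2k} ∖ Ord_{2k−1} ≠ ∅`), **`setOf_orderOf_ssubset`** (`Ord_{2k−1} ⊊ Ord_{2k}`);
  and §4 THEOREM 3 (1) ⟺ (2), p0007 L59–p0008 L10: "Strong Goldbach Conjecture. Every even natural number `x`
  greater than six can be written as the sum of two distinct odd primes. … Theorem 3. The following statements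
  are equivalent: 1. the strong Goldbach conjecture is true; 2. for each even `n ≥ 6` there is an `n × n`
  integer matrix of order `pq` for distinct odd primes `p` and `q`, and there is no smaller integer matrix of
  this order … it suffices to note that for `n ≥ 6` one has `n + 2 = p + q` for distinct odd primes `p` and `q`
  if and only if `n = (p − 1) + (q − 1) = ψ(pq)`" — `crPsi_mul_of_prime_of_prime`, `crPsi_mul_eq_iff_add_two_eq_add`,
  `exists_orderOf_eq_and_forall_lt_iff_crPsi_eq` (`Ord_n ∖ Ord_{n−1} = ψ⁻¹{n}` elementwise),
  **`strongGoldbach_iff_forall_exists_matrix_orderOf_mul`** (an `↔` of two stated propositions; the conjecture is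
  NOT asserted and no named fact is introduced).

## References

* [BambergCairnsKilminster2003] J. Bamberg, G. Cairns, D. Kilminster, *The crystallographic restriction,
  permutations, and Goldbach's conjecture*, Amer. Math. Monthly 110 (2003) 202–209, Thm. 1.
* [KuzmanovichPavlichenkov2002] J. Kuzmanovich, A. Pavlichenkov, *Finite groups of matrices whose
  entries are integers*, Amer. Math. Monthly 109 (2002) 173–186, Thm. 2.7.
-/

noncomputable section

open Polynomial Finset Function

namespace Literature.LinearAlgebra.Matrix

/-! ### The cyclotomic block: `X mod ∏_{p ∣ m} Φ_{p^{v_p(m)}}` is a primitive `m`-th root of unity -/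

/-- `∏_{p ∣ m} Φ_{p^{v_p(m)}}` is monic. [folklore] -/
private theorem cycProd_monic (m : ℕ) : (∏ p ∈ m.primeFactors, cyclotomic (p ^ m.factorization p) ℤ).Monic :=
  monic_prod_of_monic _ _ fun _ _ ↦ cyclotomic.monic _ ℤ

/-- `deg ∏_{p ∣ m} Φ_{p^{v_p(m)}} = Σ_{p ∣ m} φ(p^{v_p(m)})`. [folklore] -/
private theorem natDegree_cycProd (m : ℕ) :
    (∏ p ∈ m.primeFactors, cyclotomic (p ^ m.factorization p) ℤ).natDegree =
      ∑ p ∈ m.primeFactors, Nat.totient (p ^ m.factorization p) := by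
  rw [natDegree_prod_of_monic _ _ fun _ _ ↦ cyclotomic.monic _ ℤ]
  simp only [natDegree_cyclotomic]

/-- `Φ_d ∣ X^k − 1` in `ℤ[X]` forces `d ∣ k` (`d ≥ 1`): evaluate at a primitive `d`-th root of unity in
`ℂ`. [folklore] -/
private theorem dvd_of_cyclotomic_dvd_X_pow_sub_one {d k : ℕ} (hd : 0 < d)
    (h : cyclotomic d ℤ ∣ X ^ k - 1) : d ∣ k := by
  have hζ := Complex.isPrimitiveRoot_exp d hd.ne'
  set ζ := Complex.exp (2 * Real.pi * Complex.I / d)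
  haveI : NeZero (d : ℂ) := ⟨Nat.cast_ne_zero.2 hd.ne'⟩
  have hroot : IsRoot (cyclotomic d ℂ) ζ := isRoot_cyclotomic_iff.2 hζ
  have hmap : cyclotomic d ℂ ∣ X ^ k - 1 := by
    have h' := Polynomial.map_dvd (Int.castRingHom ℂ) h
    simpa [map_cyclotomic] using h'
  have hk : IsRoot (X ^ k - 1 : ℂ[X]) ζ := hroot.dvd hmap
  rw [IsRoot.def, eval_sub, eval_pow, eval_X, eval_one, sub_eq_zero] at hk
  exact hζ.dvd_of_pow_eq_one k hk

/-- `∏_{p ∣ m} Φ_{p^{v_p(m)}} ∣ X^m − 1` (`X^m − 1 = ∏_{e ∣ m} Φ_e` and the maximal prime powers are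
distinct divisors of `m`). [folklore] -/
private theorem cycProd_dvd_X_pow_sub_one {m : ℕ} (hm : 0 < m) :
    ∏ p ∈ m.primeFactors, cyclotomic (p ^ m.factorization p) ℤ ∣ X ^ m - 1 := by
  classical
  rw [← prod_cyclotomic_eq_X_pow_sub_one hm ℤ]
  -- rewrite as a product over the image finset of maximal prime powers
  have hinj : Set.InjOn (fun p ↦ p ^ m.factorization p) m.primeFactors := by
    intro p hp q hq hpq
    have hpp := Nat.prime_of_mem_primeFactors hp
    have hqq := Nat.prime_of_mem_primeFactors hq
    have hvp : 0 < m.factorization p :=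
      hpp.factorization_pos_of_dvd hm.ne' (Nat.dvd_of_mem_primeFactors hp)
    have hpq' : p ^ m.factorization p = q ^ m.factorization q := hpq
    have h1 : p ∣ q ^ m.factorization q := by
      rw [← hpq']; exact dvd_pow_self p hvp.ne'
    exact (Nat.prime_dvd_prime_iff_eq hpp hqq).1 (hpp.dvd_of_dvd_pow h1)
  rw [← Finset.prod_image (s := m.primeFactors) (g := fun p ↦ p ^ m.factorization p)
    (f := fun d ↦ cyclotomic d ℤ) hinj]
  refine Finset.prod_dvd_prod_of_subset _ _ _ fun d hd ↦ ?_
  rw [Finset.mem_image] at hd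
  obtain ⟨p, hp, rfl⟩ := hd
  exact Nat.mem_divisors.2 ⟨Nat.ordProj_dvd m p, hm.ne'⟩

/-- **The class of `X` in `ℤ[X]/(∏_{p ∣ m} Φ_{p^{v_p(m)}})` is a primitive `m`-th root of unity.**
[cite: KuzmanovichPavlichenkov2002, Thm. 2.7 (proof)] -/
theorem isPrimitiveRoot_root_prod_cyclotomic {m : ℕ} (hm : 0 < m) :
    IsPrimitiveRoot
      (AdjoinRoot.root (∏ p ∈ m.primeFactors, cyclotomic (p ^ m.factorization p) ℤ)) m := by
  have hmk : ∀ k : ℕ,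
      AdjoinRoot.root (∏ p ∈ m.primeFactors, cyclotomic (p ^ m.factorization p) ℤ) ^ k - 1 =
        AdjoinRoot.mk (∏ p ∈ m.primeFactors, cyclotomic (p ^ m.factorization p) ℤ) (X ^ k - 1) :=
    fun k ↦ by rw [map_sub, map_pow, AdjoinRoot.mk_X, map_one]
  refine ⟨?_, fun l hl ↦ ?_⟩
  · rw [← sub_eq_zero, hmk, AdjoinRoot.mk_eq_zero]
    exact cycProd_dvd_X_pow_sub_one hm
  · rw [← sub_eq_zero, hmk, AdjoinRoot.mk_eq_zero] at hl
    rcases Nat.eq_zero_or_pos l with rfl | hl0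
    · exact dvd_zero m
    rw [← Nat.factorization_le_iff_dvd hm.ne' hl0.ne', Finsupp.le_def]
    intro p
    by_cases hp : p ∈ m.primeFactors
    · have hpp := Nat.prime_of_mem_primeFactors hp
      have hdvd : cyclotomic (p ^ m.factorization p) ℤ ∣ X ^ l - 1 :=
        dvd_trans (Finset.dvd_prod_of_mem (fun q ↦ cyclotomic (q ^ m.factorization q) ℤ) hp) hl
      have hpl : p ^ m.factorization p ∣ l :=
        dvd_of_cyclotomic_dvd_X_pow_sub_one (pow_pos hpp.pos _) hdvd
      exact (hpp.pow_dvd_iff_le_factorization hl0.ne').1 hpl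
    · rw [Finsupp.notMem_support_iff.1 hp]
      exact Nat.zero_le _

/-- `ord (X mod ∏ Φ) = m`. [cite: KuzmanovichPavlichenkov2002, Thm. 2.7 (proof)] -/
theorem orderOf_root_prod_cyclotomic {m : ℕ} (hm : 0 < m) :
    orderOf (AdjoinRoot.root (∏ p ∈ m.primeFactors, cyclotomic (p ^ m.factorization p) ℤ)) = m :=
  (isPrimitiveRoot_root_prod_cyclotomic hm).eq_orderOf.symm

/-! ### From a ring element of order `m` to an integer matrix of order `m` -/

/-- The regular representation in the power basis of `ℤ[X]/(g)`, `g` monic: an INTEGER MATRIX of size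
`deg g` with the same multiplicative order as the given element. [folklore] -/
private theorem exists_matrix_orderOf_eq_of_monic {g : ℤ[X]} (hg : g.Monic) (x : AdjoinRoot g) :
    ∃ A : _root_.Matrix (Fin g.natDegree) (Fin g.natDegree) ℤ, orderOf A = orderOf x := by
  classical
  let pb := AdjoinRoot.powerBasis' hg
  refine ⟨Algebra.leftMulMatrix pb.basis x, ?_⟩
  exact orderOf_injective (Algebra.leftMulMatrix pb.basis).toMonoidHom
    (Algebra.leftMulMatrix_injective pb.basis) x

/-- Reindexing along an equivalence of index types preserves the order. [folklore] -/
private theorem orderOf_reindex {κ κ' : Type*} [Fintype κ] [Fintype κ'] [DecidableEq κ] [DecidableEq κ']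
    (e : κ ≃ κ') (A : _root_.Matrix κ κ ℤ) : orderOf (Matrix.reindex e e A) = orderOf A :=
  orderOf_injective (Matrix.reindexAlgEquiv ℤ ℤ e).toMonoidHom
    (Matrix.reindexAlgEquiv ℤ ℤ e).injective A

/-- Padding by an identity block preserves the order: `ord (A ⊕ 1) = ord A`. [folklore] -/
private theorem orderOf_fromBlocks_one {κ κ' : Type*} [Fintype κ] [Fintype κ'] [DecidableEq κ]
    [DecidableEq κ'] (A : _root_.Matrix κ κ ℤ) :
    orderOf (Matrix.fromBlocks A 0 0 (1 : _root_.Matrix κ' κ' ℤ)) = orderOf A := by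
  let F : _root_.Matrix κ κ ℤ →* _root_.Matrix (κ ⊕ κ') (κ ⊕ κ') ℤ :=
    { toFun := fun M ↦ Matrix.fromBlocks M 0 0 1
      map_one' := Matrix.fromBlocks_one
      map_mul' := fun M N ↦ by simp [Matrix.fromBlocks_multiply] }
  have hF : Injective F := fun M N h ↦ (Matrix.fromBlocks_inj.1 h).1
  exact orderOf_injective F hF A

/-- An integer matrix of size `s` and order `m` gives one of every size `n ≥ s`. [folklore] -/
private theorem exists_matrix_orderOf_eq_of_le {s n m : ℕ} (hsn : s ≤ n)
    (h : ∃ A : _root_.Matrix (Fin s) (Fin s) ℤ, orderOf A = m) :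
    ∃ A : _root_.Matrix (Fin n) (Fin n) ℤ, orderOf A = m := by
  obtain ⟨A, hA⟩ := h
  let e : Fin s ⊕ Fin (n - s) ≃ Fin n := finSumFinEquiv.trans (finCongr (Nat.add_sub_cancel' hsn))
  exact ⟨Matrix.reindex e e (Matrix.fromBlocks A 0 0 1), by
    rw [orderOf_reindex, orderOf_fromBlocks_one, hA]⟩

/-- `ord (−1) = 2` for integer matrices of positive size. [folklore] -/
private theorem orderOf_neg_one {s : ℕ} (hs : 0 < s) :
    orderOf (-1 : _root_.Matrix (Fin s) (Fin s) ℤ) = 2 := by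
  refine orderOf_eq_prime (by rw [neg_one_sq]) fun h ↦ ?_
  have h00 := congrFun (congrFun h ⟨0, hs⟩) ⟨0, hs⟩
  simp at h00

/-- MINUS a matrix of odd order `m'` (positive size) has order `2m'`. [folklore] -/
private theorem orderOf_neg_of_odd {s : ℕ} (hs : 0 < s) {A : _root_.Matrix (Fin s) (Fin s) ℤ} {m' : ℕ}
    (hA : orderOf A = m') (hodd : Odd m') : orderOf (-A) = 2 * m' := by
  have hcop : (orderOf (-1 : _root_.Matrix (Fin s) (Fin s) ℤ)).Coprime (orderOf A) := by
    rw [orderOf_neg_one hs, hA]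
    exact Nat.coprime_two_left.2 hodd
  rw [← neg_one_mul, (Commute.neg_one_left A).orderOf_mul_eq_mul_orderOf_of_coprime hcop,
    orderOf_neg_one hs, hA]

/-! ### `ψ` versus `Σ_p φ(p^{v_p(m)})` -/

/-- `p^v = 2` for a prime `p` forces `p = 2`, `v = 1`. [folklore] -/
private theorem prime_pow_eq_two {p v : ℕ} (hp : p.Prime) (h : p ^ v = 2) : p = 2 ∧ v = 1 := by
  have hv : v ≠ 0 := by
    rintro rfl
    simp at h
  have hp2 : p = 2 := by
    have hd : p ∣ 2 := by rw [← h]; exact dvd_pow_self p hv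
    exact (Nat.prime_dvd_prime_iff_eq hp Nat.prime_two).1 hd
  subst hp2
  exact ⟨rfl, Nat.pow_right_injective (le_refl 2) (by simpa using h)⟩

/-- If `v₂(m) ≠ 1` then `ψ(m) = Σ_{p ∣ m} φ(p^{v_p(m)})` (no summand is the exceptional `φ(2)`).
[cite: BambergCairnsKilminster2003, Thm. 1 (definition of ψ)] -/
theorem crPsi_eq_sum_totient_of_ne {m : ℕ} (h2 : m.factorization 2 ≠ 1) :
    crPsi m = ∑ p ∈ m.primeFactors, Nat.totient (p ^ m.factorization p) := by
  rw [crPsi_def]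
  refine Finset.sum_congr rfl fun p hp ↦ ?_
  rw [if_neg]
  intro hp2
  obtain ⟨rfl, hv⟩ := prime_pow_eq_two (Nat.prime_of_mem_primeFactors hp) hp2
  exact h2 hv

/-! ### The construction -/

/-- **Case `v₂(m) ≠ 1`: an integer matrix of size `ψ(m)` and order `m`** — the regular representation
of `X mod ∏_{p ∣ m} Φ_{p^{v_p(m)}}` (block sum of the companion matrices of the `Φ_{p^{v_p(m)}}`).
[cite: KuzmanovichPavlichenkov2002, Thm. 2.7 (proof)] -/
theorem exists_matrix_orderOf_eq_of_ne {m : ℕ} (hm : 0 < m) (h2 : m.factorization 2 ≠ 1) :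
    ∃ A : _root_.Matrix (Fin (crPsi m)) (Fin (crPsi m)) ℤ, orderOf A = m := by
  obtain ⟨A, hA⟩ := exists_matrix_orderOf_eq_of_monic (cycProd_monic m)
    (AdjoinRoot.root (∏ p ∈ m.primeFactors, cyclotomic (p ^ m.factorization p) ℤ))
  rw [orderOf_root_prod_cyclotomic hm] at hA
  have hdeg : (∏ p ∈ m.primeFactors, cyclotomic (p ^ m.factorization p) ℤ).natDegree = crPsi m := by
    rw [natDegree_cycProd, crPsi_eq_sum_totient_of_ne h2]
  exact ⟨Matrix.reindex (finCongr hdeg) (finCongr hdeg) A, by rw [orderOf_reindex, hA]⟩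

/-- **Case `v₂(m) = 1`, `m ≠ 2` (the exception `ψ(2) = 0`): an integer matrix of size `ψ(m)` and
order `m`** — MINUS the matrix for the odd number `m/2` (`ψ(m) = ψ(m/2)`, and `−B` has order
`2 · (m/2) = m`). [cite: KuzmanovichPavlichenkov2002, Thm. 2.7 (proof)] -/
theorem exists_matrix_orderOf_eq_of_eq {m : ℕ} (hm : 0 < m) (h2 : m.factorization 2 = 1)
    (hm2 : m ≠ 2) : ∃ A : _root_.Matrix (Fin (crPsi m)) (Fin (crPsi m)) ℤ, orderOf A = m := by
  -- `m = 2 m'` with `m'` odd, `m' > 1`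
  have h2m : 2 ∣ m := Nat.dvd_of_factorization_pos (by rw [h2]; exact one_ne_zero)
  set m' := m / 2 with hm'
  have hmm : m = 2 * m' := (Nat.mul_div_cancel' h2m).symm
  have hm'0 : 0 < m' := Nat.div_pos (Nat.le_of_dvd hm h2m) two_pos
  have hv2 : m'.factorization 2 = 0 := by
    rw [hm', Nat.factorization_div h2m, Finsupp.tsub_apply, h2, Nat.prime_two.factorization_self]
  have hodd : Odd m' := by
    refine Nat.not_even_iff_odd.1 fun hev ↦ ?_
    rcases (Nat.factorization_eq_zero_iff _ _).1 hv2 with h | h | h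
    · exact h Nat.prime_two
    · exact h (even_iff_two_dvd.1 hev)
    · exact hm'0.ne' h
  have hcop : Nat.Coprime 2 m' := Nat.coprime_two_left.2 hodd
  have hψ : crPsi m = crPsi m' := by rw [hmm, crPsi_mul_of_coprime hcop, crPsi_two, zero_add]
  -- the matrix for `m'`
  obtain ⟨B, hB⟩ := exists_matrix_orderOf_eq_of_ne hm'0 (by rw [hv2]; exact zero_ne_one)
  -- its size is positive: `m' > 1` has an odd prime factor `p`, `φ(p^{v_p}) ≥ 1`
  have hm'1 : m' ≠ 1 := fun h ↦ hm2 (by rw [hmm, h, mul_one])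
  have hpos : 0 < crPsi m' := by
    obtain ⟨p, hp⟩ : m'.primeFactors.Nonempty := by
      rwa [Finset.nonempty_iff_ne_empty, Ne, Nat.primeFactors_eq_empty, not_or, and_iff_right hm'0.ne']
    have hpp := Nat.prime_of_mem_primeFactors hp
    have hne : p ^ m'.factorization p ≠ 2 := fun he ↦ by
      obtain ⟨rfl, hv⟩ := prime_pow_eq_two hpp he
      rw [hv2] at hv
      exact zero_ne_one hv
    exact (Nat.totient_pos.2 (pow_pos hpp.pos _)).trans_le (totient_ordProj_le_crPsi hp hne)
  refine ⟨-(Matrix.reindex (finCongr hψ.symm) (finCongr hψ.symm) B), ?_⟩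
  have hB' : orderOf (Matrix.reindex (finCongr hψ.symm) (finCongr hψ.symm) B) = m' := by
    rw [orderOf_reindex, hB]
  rw [orderOf_neg_of_odd (hψ ▸ hpos) hB' hodd, ← hmm]

/-- **Bamberg–Cairns–Kilminster Theorem 1, the inclusion `⊇`: every `m ≥ 1` with `ψ(m) ≤ n` (`n ≥ 1`) is
the order of an `n × n` integer matrix.** [cite: BambergCairnsKilminster2003, Thm. 1]
[cite: KuzmanovichPavlichenkov2002, Thm. 2.7] -/
theorem exists_matrix_orderOf_eq_of_crPsi_le {m n : ℕ} (hm : 0 < m) (hn : 0 < n) (h : crPsi m ≤ n) :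
    ∃ A : _root_.Matrix (Fin n) (Fin n) ℤ, orderOf A = m := by
  by_cases hm2 : m = 2
  · subst hm2
    exact ⟨-1, orderOf_neg_one hn⟩
  by_cases h2 : m.factorization 2 = 1
  · exact exists_matrix_orderOf_eq_of_le h (exists_matrix_orderOf_eq_of_eq hm h2 hm2)
  · exact exists_matrix_orderOf_eq_of_le h (exists_matrix_orderOf_eq_of_ne hm h2)

/-- The same in `GL_n(ℤ)` (a matrix of finite order is invertible): **`ψ(m) ≤ n ⟹ m ∈ Ord_n`**.
[cite: BambergCairnsKilminster2003, Thm. 1] -/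
theorem exists_gl_orderOf_eq_of_crPsi_le {m n : ℕ} (hm : 0 < m) (hn : 0 < n) (h : crPsi m ≤ n) :
    ∃ A : GL (Fin n) ℤ, orderOf A = m := by
  obtain ⟨A, hA⟩ := exists_matrix_orderOf_eq_of_crPsi_le hm hn h
  have hfin : IsOfFinOrder A := orderOf_pos_iff.1 (hA ▸ hm)
  exact ⟨hfin.unit, by rw [← orderOf_units, IsOfFinOrder.val_unit, hA]⟩

/-- **Theorem 1 of Bamberg–Cairns–Kilminster (2003): `Ord_n = {m ∈ ℕ | ψ(m) ≤ n}`** — for `n ≥ 1`, the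
finite orders `m ≥ 1` of `n × n` integer matrices are exactly the `m ≥ 1` with `ψ(m) ≤ n` (`⊆`:
`crPsi_orderOf_le_card_int`; `⊇`: `exists_matrix_orderOf_eq_of_crPsi_le`).
[cite: BambergCairnsKilminster2003, Thm. 1] -/
theorem setOf_orderOf_eq_setOf_crPsi_le {n : ℕ} (hn : 0 < n) :
    {m : ℕ | 0 < m ∧ ∃ A : _root_.Matrix (Fin n) (Fin n) ℤ, orderOf A = m} =
      {m : ℕ | 0 < m ∧ crPsi m ≤ n} := by
  ext m
  simp only [Set.mem_setOf_eq]
  constructor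
  · rintro ⟨hm, A, hA⟩
    refine ⟨hm, ?_⟩
    have h := crPsi_orderOf_le_card_int A (hA ▸ hm)
    rwa [hA, Fintype.card_fin] at h
  · rintro ⟨hm, h⟩
    exact ⟨hm, exists_matrix_orderOf_eq_of_crPsi_le hm hn h⟩

/-- The sharp bounds of Table 1 are attained: there are integer matrices of size `2`, `4`, `6` of order
`6`, `12`, `30` respectively (`ψ(6) = 2`, `ψ(12) = 4`, `ψ(30) = 6`).
[cite: BambergCairnsKilminster2003, Thm. 1 and Table 1] -/
theorem exists_matrix_orderOf_eq_six_twelve_thirty :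
    (∃ A : _root_.Matrix (Fin 2) (Fin 2) ℤ, orderOf A = 6) ∧
      (∃ A : _root_.Matrix (Fin 4) (Fin 4) ℤ, orderOf A = 12) ∧
        ∃ A : _root_.Matrix (Fin 6) (Fin 6) ℤ, orderOf A = 30 := by
  refine ⟨exists_matrix_orderOf_eq_of_crPsi_le (by norm_num) (by norm_num) ?_,
    exists_matrix_orderOf_eq_of_crPsi_le (by norm_num) (by norm_num) ?_,
    exists_matrix_orderOf_eq_of_crPsi_le (by norm_num) (by norm_num) ?_⟩
  · exact ((crPsi_le_two_iff (by norm_num)).2 (by simp)).trans le_rfl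
  · exact ((crPsi_le_four_iff (by norm_num)).2 (by simp)).trans le_rfl
  · exact ((crPsi_le_six_iff (by norm_num)).2 (by simp)).trans le_rfl

/-! ### `ψ` is even, hence `Ord_{2k+1} = Ord_{2k}` -/

/-- **"Notice that `ψ(m)` is even for all `m`"**: every summand `ψ(p^{v_p(m)})` is `0` or `φ(q)` with
`q = p^{v_p(m)} > 2`, which is even. [cite: BambergCairnsKilminster2003, p. 2 (after Thm. 1)] -/
theorem even_crPsi (m : ℕ) : Even (crPsi m) := by
  rw [crPsi_def]
  refine Finset.even_sum _ fun p hp ↦ ?_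
  split_ifs with h2
  · exact Even.zero
  · have hpp := Nat.prime_of_mem_primeFactors hp
    have hv : 0 < m.factorization p :=
      hpp.factorization_pos_of_dvd (Nat.mem_primeFactors.1 hp).2.2 (Nat.mem_primeFactors.1 hp).2.1
    have h2le : 2 ≤ p ^ m.factorization p := hpp.two_le.trans (Nat.le_self_pow hv.ne' p)
    exact Nat.totient_even (by omega)

/-- `ψ(m) ≤ 2k + 1 ⟺ ψ(m) ≤ 2k` (`ψ(m)` is even). [cite: BambergCairnsKilminster2003, p. 2 (after Thm. 1)] -/
theorem crPsi_le_two_mul_add_one_iff (m k : ℕ) : crPsi m ≤ 2 * k + 1 ↔ crPsi m ≤ 2 * k := by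
  obtain ⟨j, hj⟩ := even_crPsi m
  omega

/-- **"… so `Ord_{2k+1} = Ord_{2k}` for all `k ≥ 1`"**: the orders of `(2k+1) × (2k+1)` integer matrices are
the orders of `2k × 2k` integer matrices. [cite: BambergCairnsKilminster2003, p. 2 (after Thm. 1) and Thm. 1] -/
theorem setOf_orderOf_odd_eq_setOf_orderOf_even {k : ℕ} (hk : 0 < k) :
    {m : ℕ | 0 < m ∧ ∃ A : _root_.Matrix (Fin (2 * k + 1)) (Fin (2 * k + 1)) ℤ, orderOf A = m} =
      {m : ℕ | 0 < m ∧ ∃ A : _root_.Matrix (Fin (2 * k)) (Fin (2 * k)) ℤ, orderOf A = m} := by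
  rw [setOf_orderOf_eq_setOf_crPsi_le (by omega), setOf_orderOf_eq_setOf_crPsi_le (by omega)]
  ext m
  simp only [Set.mem_setOf_eq, crPsi_le_two_mul_add_one_iff]

/-- **Hence it suffices to consider `Ord_n` for even `n`**: `Ord_n = Ord_{2⌊n/2⌋}` for `n ≥ 2`.
[cite: BambergCairnsKilminster2003, p. 2 (after Thm. 1)] -/
theorem setOf_orderOf_eq_setOf_orderOf_two_mul_div_two {n : ℕ} (hn : 2 ≤ n) :
    {m : ℕ | 0 < m ∧ ∃ A : _root_.Matrix (Fin n) (Fin n) ℤ, orderOf A = m} =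
      {m : ℕ | 0 < m ∧ ∃ A : _root_.Matrix (Fin (2 * (n / 2))) (Fin (2 * (n / 2))) ℤ, orderOf A = m} := by
  rw [setOf_orderOf_eq_setOf_crPsi_le (by omega), setOf_orderOf_eq_setOf_crPsi_le (by omega)]
  ext m
  simp only [Set.mem_setOf_eq]
  obtain ⟨j, hj⟩ := even_crPsi m
  omega

/-! ### Proposition 3 (2): `ψ` maps `ℕ` onto the even numbers, hence `Ord_{2k−1} ⊊ Ord_{2k}` -/

/-- The prime factors of an ODD `m` are at most `ψ(m) + 1` ("`pᵢ = φ(pᵢ) + 1 ≤ ψ(p₁ ⋯ p_k) + 1`").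
[cite: BambergCairnsKilminster2003, Prop. 3 (2), proof (p. 6)] -/
theorem le_crPsi_add_one_of_mem_primeFactors_of_odd {m p : ℕ} (hm : Odd m) (hp : p ∈ m.primeFactors) :
    p ≤ crPsi m + 1 := by
  obtain ⟨hpp, hpd, hm0⟩ := Nat.mem_primeFactors.1 hp
  have hp2 : p ≠ 2 := by
    rintro rfl
    exact (Nat.not_even_iff_odd.2 hm) (even_iff_two_dvd.2 hpd)
  have hv : 0 < m.factorization p := hpp.factorization_pos_of_dvd hm0 hpd
  have hne : p ^ m.factorization p ≠ 2 := fun h ↦ by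
    have hd : p ∣ 2 := by rw [← h]; exact dvd_pow_self p hv.ne'
    exact hp2 ((Nat.prime_dvd_prime_iff_eq hpp Nat.prime_two).1 hd)
  have h1 := totient_ordProj_le_crPsi hp hne
  -- `p − 1 ≤ φ(p^v)` : `φ(p^v) = p^{v−1}(p − 1)`
  have h2 : p - 1 ≤ Nat.totient (p ^ m.factorization p) := by
    rw [Nat.totient_prime_pow hpp hv]
    exact Nat.le_mul_of_pos_left _ (pow_pos hpp.pos _)
  omega

/-- **Proposition 3 (2) of Bamberg–Cairns–Kilminster: `ψ` maps `ℕ` onto the even numbers — "for every even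
number `n ≥ 2` there are distinct odd primes `p₁, …, p_k` such that `ψ(p₁ ⋯ p_k) = n`"** (an odd squarefree
`m` with `ψ(m) = n`), by the printed induction on `n` with Bertrand's postulate: a prime `p` with
`x + 1 < p ≤ 2x + 1 = n + 1`; if `p = n + 1` then `ψ(p) = n`, else apply the induction hypothesis to
`n' = n − p + 1` and multiply by `p` (all prime factors of the witness for `n'` are `< p`).
[cite: BambergCairnsKilminster2003, Prop. 3 (2) and its proof (p. 6)] -/
theorem exists_odd_squarefree_crPsi_eq {n : ℕ} (hn : Even n) (h2 : 2 ≤ n) :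
    ∃ m, Odd m ∧ Squarefree m ∧ crPsi m = n := by
  induction n using Nat.strong_induction_on with
  | _ n ih =>
    obtain ⟨x, hx⟩ := hn
    -- Bertrand: a prime `p` with `x + 1 < p ≤ 2(x + 1)`, hence `p ≤ 2x + 1 = n + 1` (`2x + 2` is not prime)
    obtain ⟨p, hp, hxp, hp2x⟩ := Nat.exists_prime_lt_and_le_two_mul (x + 1) (Nat.succ_ne_zero x)
    have hp2 : p ≠ 2 := by omega
    have hpodd : Odd p := hp.odd_of_ne_two hp2
    have hple : p ≤ n + 1 := by
      rcases hp2x.lt_or_eq with h | h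
      · omega
      · exfalso
        refine (Nat.not_even_iff_odd.2 hpodd) ⟨x + 1, by omega⟩
    rcases hple.lt_or_eq with hlt | heq
    · -- the inductive case: `n' = n − p + 1`
      have hn'lt : n - p + 1 < n := by omega
      have hn'ev : Even (n - p + 1) := by
        obtain ⟨y, hy⟩ := hpodd
        exact ⟨x - y, by omega⟩
      have hn'2 : 2 ≤ n - p + 1 := by
        obtain ⟨z, hz⟩ := hn'ev
        omega
      obtain ⟨m', hm'odd, hm'sq, hm'ψ⟩ := ih (n - p + 1) hn'lt hn'ev hn'2
      -- every prime factor of `m'` is `< p`, so `p ∤ m'`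
      have hpm' : ¬p ∣ m' := fun hd ↦ by
        have hm'0 : m' ≠ 0 := fun h ↦ by
          rw [h] at hm'odd
          exact (Nat.not_even_iff_odd.2 hm'odd) Even.zero
        have hle := le_crPsi_add_one_of_mem_primeFactors_of_odd hm'odd (Nat.mem_primeFactors.2 ⟨hp, hd, hm'0⟩)
        omega
      have hcop : Nat.Coprime m' p := (Nat.coprime_comm.1 ((Nat.Prime.coprime_iff_not_dvd hp).2 hpm'))
      refine ⟨m' * p, hm'odd.mul hpodd, (Nat.squarefree_mul hcop).2 ⟨hm'sq, hp.squarefree⟩, ?_⟩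
      rw [crPsi_mul_of_coprime hcop, hm'ψ, crPsi_prime hp hp2]
      omega
    · -- `p = n + 1`: `ψ(p) = n`
      exact ⟨p, hpodd, hp.squarefree, by rw [crPsi_prime hp hp2]; omega⟩

/-- **`ψ⁻¹{n} ≠ ∅` for every even `n ≥ 0`** (`ψ(1) = 0`). [cite: BambergCairnsKilminster2003, Prop. 3 (2)] -/
theorem exists_crPsi_eq_of_even {n : ℕ} (hn : Even n) : ∃ m, 0 < m ∧ crPsi m = n := by
  rcases Nat.lt_or_ge n 2 with h | h
  · obtain ⟨x, hx⟩ := hn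
    exact ⟨1, one_pos, by rw [crPsi_one]; omega⟩
  · obtain ⟨m, hm, -, hψ⟩ := exists_odd_squarefree_crPsi_eq hn h
    exact ⟨m, hm.pos, hψ⟩

/-- **`ψ(ℕ)` is exactly the set of even numbers** (Prop. 3 (2) with "`ψ(m)` is even for all `m`").
[cite: BambergCairnsKilminster2003, Prop. 3 (2) and p. 2] -/
theorem range_crPsi : Set.range crPsi = {n | Even n} := by
  ext n
  exact ⟨fun ⟨m, hm⟩ ↦ hm ▸ even_crPsi m, fun hn ↦ let ⟨m, _, hm⟩ := exists_crPsi_eq_of_even hn; ⟨m, hm⟩⟩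

/-- **`Ord_{2k} ∖ Ord_{2k−1} = ψ⁻¹{2k} ≠ ∅`: for every `k ≥ 1` some order of a `2k × 2k` integer matrix is
the order of no smaller integer matrix.** [cite: BambergCairnsKilminster2003, Prop. 3 (2) and p. 2 (`Ord_n ∖ Ord_{n−1} = ψ⁻¹{n}`)] -/
theorem exists_orderOf_eq_and_not {k : ℕ} (hk : 0 < k) :
    ∃ m, 0 < m ∧ (∃ A : _root_.Matrix (Fin (2 * k)) (Fin (2 * k)) ℤ, orderOf A = m) ∧
      ¬∃ A : _root_.Matrix (Fin (2 * k - 1)) (Fin (2 * k - 1)) ℤ, orderOf A = m := by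
  obtain ⟨m, hm, hψ⟩ := exists_crPsi_eq_of_even (even_two_mul k)
  refine ⟨m, hm, exists_matrix_orderOf_eq_of_crPsi_le hm (by omega) hψ.le, ?_⟩
  rintro ⟨A, hA⟩
  have h := crPsi_orderOf_le_card_int A (hA ▸ hm)
  rw [hA, Fintype.card_fin, hψ] at h
  omega

/-- **The crystallographic restriction grows at every even step: `Ord_{2k−1} ⊊ Ord_{2k}`** (`k ≥ 1`).
[cite: BambergCairnsKilminster2003, Prop. 3 (2) and Thm. 1] -/
theorem setOf_orderOf_ssubset {k : ℕ} (hk : 0 < k) :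
    {m : ℕ | 0 < m ∧ ∃ A : _root_.Matrix (Fin (2 * k - 1)) (Fin (2 * k - 1)) ℤ, orderOf A = m} ⊂
      {m : ℕ | 0 < m ∧ ∃ A : _root_.Matrix (Fin (2 * k)) (Fin (2 * k)) ℤ, orderOf A = m} := by
  rw [setOf_orderOf_eq_setOf_crPsi_le (by omega), setOf_orderOf_eq_setOf_crPsi_le (by omega),
    Set.ssubset_iff_subset_ne]
  refine ⟨fun m hm ↦ ⟨hm.1, hm.2.trans (by omega)⟩, fun h ↦ ?_⟩
  obtain ⟨m, hm, hψ⟩ := exists_crPsi_eq_of_even (even_two_mul k)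
  have hmem : m ∈ {m : ℕ | 0 < m ∧ crPsi m ≤ 2 * k} := ⟨hm, hψ.le⟩
  rw [← h] at hmem
  have := hmem.2
  omega

/-! ### Theorem 3 (1) ⟺ (2): the strong Goldbach conjecture and the crystallographic restriction -/

/-- `ψ(pq) = (p − 1) + (q − 1)` for distinct odd primes `p`, `q`. [cite: BambergCairnsKilminster2003, Thm. 3, proof (p. 8)] -/
theorem crPsi_mul_of_prime_of_prime {p q : ℕ} (hp : p.Prime) (hq : q.Prime) (hpq : p ≠ q) (hp2 : p ≠ 2)
    (hq2 : q ≠ 2) : crPsi (p * q) = (p - 1) + (q - 1) := by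
  rw [crPsi_mul_of_coprime ((Nat.coprime_primes hp hq).2 hpq), crPsi_prime hp hp2, crPsi_prime hq hq2]

/-- "For `n ≥ 6` one has `n + 2 = p + q` for distinct odd primes `p` and `q` if and only if
`n = (p − 1) + (q − 1) = ψ(pq)`." [cite: BambergCairnsKilminster2003, Thm. 3, proof (p. 8)] -/
theorem crPsi_mul_eq_iff_add_two_eq_add {p q n : ℕ} (hp : p.Prime) (hq : q.Prime) (hpq : p ≠ q) (hp2 : p ≠ 2)
    (hq2 : q ≠ 2) : crPsi (p * q) = n ↔ n + 2 = p + q := by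
  rw [crPsi_mul_of_prime_of_prime hp hq hpq hp2 hq2]
  have := hp.two_le
  have := hq.two_le
  omega

/-- **An `n × n` integer matrix of order `m` exists and no smaller one does iff `ψ(m) = n`** (`m ≥ 1`; Theorem 1
read as `Ord_n ∖ Ord_{n−1} = ψ⁻¹{n}`). [cite: BambergCairnsKilminster2003, Thm. 1 and p. 2 (`Ord_n ∖ Ord_{n−1} = ψ⁻¹{n}`)] -/
theorem exists_orderOf_eq_and_forall_lt_iff_crPsi_eq {m n : ℕ} (hm : 0 < m) (hψ : 0 < crPsi m) :
    ((∃ A : _root_.Matrix (Fin n) (Fin n) ℤ, orderOf A = m) ∧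
        ∀ k < n, ¬∃ A : _root_.Matrix (Fin k) (Fin k) ℤ, orderOf A = m) ↔ crPsi m = n := by
  constructor
  · rintro ⟨⟨A, hA⟩, hnot⟩
    have hle : crPsi m ≤ n := by
      have h := crPsi_orderOf_le_card_int A (hA ▸ hm)
      rwa [hA, Fintype.card_fin] at h
    refine le_antisymm hle (not_lt.1 fun hlt ↦ hnot _ hlt ?_)
    exact exists_matrix_orderOf_eq_of_crPsi_le hm hψ le_rfl
  · rintro rfl
    refine ⟨exists_matrix_orderOf_eq_of_crPsi_le hm hψ le_rfl, fun k hk ⟨A, hA⟩ ↦ ?_⟩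
    have h := crPsi_orderOf_le_card_int A (hA ▸ hm)
    rw [hA, Fintype.card_fin] at h
    omega

/-- **Theorem 3, (1) ⟺ (2), of Bamberg–Cairns–Kilminster: the STRONG GOLDBACH CONJECTURE ("every even natural
number `x` greater than six can be written as the sum of two distinct odd primes") holds if and only if "for each
even `n ≥ 6` there is an `n × n` integer matrix of order `pq` for distinct odd primes `p` and `q`, and there is
no smaller integer matrix of this order"** (both sides stated verbatim as propositions; neither is asserted).
[cite: BambergCairnsKilminster2003, Thm. 3 (1) ⟺ (2) and its proof (pp. 7–8)] -/
theorem strongGoldbach_iff_forall_exists_matrix_orderOf_mul :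
    (∀ x : ℕ, Even x → 6 < x → ∃ p q : ℕ, p.Prime ∧ q.Prime ∧ p ≠ q ∧ p ≠ 2 ∧ q ≠ 2 ∧ x = p + q) ↔
      ∀ n : ℕ, Even n → 6 ≤ n → ∃ p q : ℕ, p.Prime ∧ q.Prime ∧ p ≠ q ∧ p ≠ 2 ∧ q ≠ 2 ∧
        (∃ A : _root_.Matrix (Fin n) (Fin n) ℤ, orderOf A = p * q) ∧
          ∀ k < n, ¬∃ A : _root_.Matrix (Fin k) (Fin k) ℤ, orderOf A = p * q := by
  constructor
  · intro h n hn h6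
    obtain ⟨p, q, hp, hq, hpq, hp2, hq2, hx⟩ := h (n + 2) (by obtain ⟨y, hy⟩ := hn; exact ⟨y + 1, by omega⟩)
      (by omega)
    refine ⟨p, q, hp, hq, hpq, hp2, hq2, ?_⟩
    have hψ : crPsi (p * q) = n := (crPsi_mul_eq_iff_add_two_eq_add hp hq hpq hp2 hq2).2 hx
    exact (exists_orderOf_eq_and_forall_lt_iff_crPsi_eq (Nat.mul_pos hp.pos hq.pos) (by omega)).2 hψ
  · intro h x hx h6
    obtain ⟨p, q, hp, hq, hpq, hp2, hq2, hA⟩ := h (x - 2) (by obtain ⟨y, hy⟩ := hx; exact ⟨y - 1, by omega⟩)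
      (by obtain ⟨y, hy⟩ := hx; omega)
    refine ⟨p, q, hp, hq, hpq, hp2, hq2, ?_⟩
    have hψpos : 0 < crPsi (p * q) := by
      rw [crPsi_mul_of_prime_of_prime hp hq hpq hp2 hq2]
      have := hp.two_le
      omega
    have hψ := (exists_orderOf_eq_and_forall_lt_iff_crPsi_eq (Nat.mul_pos hp.pos hq.pos) hψpos).1 hA
    have h2 := (crPsi_mul_eq_iff_add_two_eq_add hp hq hpq hp2 hq2).1 hψ
    omega

end Literature.LinearAlgebra.Matrix

end
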